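import Literature.AlgebraicGeometry.HodgeTheory.RealMultiplicationHodgeLieAlgebra
import Literature.AlgebraicGeometry.Motives.HodgeThetaSubalgebraRealPlacesSl2
import Literature.AlgebraicGeometry.HodgeTheory.AbelianVarietySlotsWordModel
import Mathlib.LinearAlgebra.BilinearForm.Properties
import HarnessLib

/-!
# The classes `b_τ 0 ⌣ b_τ 1` of an abelian variety with real multiplication of relative dimension one are combinations of rational `(1,1)`-classes; colourwise-invariant coefficient functions evaluate into `D• ⊗ ℂ` (Ribet 1983 Thm. 0; Hazama 1983 §3 — the invariant-theory half, degree two and gluing)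

Family `hodge`, layer `Literature/AlgebraicGeometry/HodgeTheory`. Research context: cell `pub-hodge-ring2`
(HONEST FRAMING: research route conditional on HC_CM; not a corollary; Q11.4-sentence-2 already refuted in
dim ≥ 3), Literature lane, real-multiplication programme R2, step R2b-ii ("Lie-to-cycles"), the CYCLE side.
This file is UNCONDITIONAL and no step towards a summit statement.

SETTING. `A` a complex abelian variety with `End⁰(A) = E` a totally real field, `[E:ℚ] = dim A`; `ψ` a
polarization of `H = H¹(A(ℂ); ℚ)`; `H ⊗ ℂ = ⊕_τ V_τ` the two-dimensional eigenblocks of `E`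
(`RealMultiplicationHodgeLieAlgebra`), `b_τ` bases of the `V_τ`; `B` an abelian variety with slots
`g : Fin n → (B ⟶ A)`; the letters `g_j^* b_τ r ∈ H¹(B(ℂ); ℂ)` (`rmLetters`).

MAIN RESULTS (all proved; no named fact, D-0026).
* §1 (the `ψ`-Casimir classes) `theta_mem_span_rational_oneOne`: for Hodge-adapted block bases
  (`b_τ 0 ∈ H^{1,0}`, `b_τ 1 ∈ H^{0,1}`) the class `θ_τ = b_τ 0 ⌣ b_τ 1 ∈ H²(A(ℂ); ℂ)` is a `ℂ`-combination
  of RATIONAL `(1,1)`-classes — the degree-two invariants `(Λ² V_τ)` of `⊕ 𝔰𝔩(V_τ)` are divisor classes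
  (Ribet: `B¹(A) ⊗ ℂ ⊇ ⊕_τ Λ² V_τ`; Hazama §3, `p = 1`). PROOF without Lefschetz (1,1) and without Hodge
  groups: the `ψ`-CASIMIR CLASS `Λ(Y) = ∑_i ρ(Y d_i) ⌣ ρ(e_i)` of an operator `Y` of `H ⊗ ℂ` (`e` a rational
  basis, `d` its `ψ`-dual basis) is independent of the pair of dual bases (`sum_dual_eq_sum_dual`); for
  `Y = a ⊗ 1`, `a ∈ End_Hdg(H)`, it is RATIONAL (rational bases) and of type `(1,1)` (adapted block bases,
  `a` is the scalar `τ(a)` on `V_τ`, the `V_τ` are `ψ_ℂ`-orthogonal and `ψ_ℂ` is alternating); the block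
  projector `p_τ` lies in `End_Hdg(H) ⊗ ℂ` (`ThetaSubalgebra.mem_span_endAlg_of_forall_commute`) and
  `Λ(p_τ) = (2/ω_τ) θ_τ`, `ω_τ = ψ_ℂ(b_τ 0, b_τ 1) ≠ 0`.
* §2 `rmLetters_cross_mem_span_rational_oneOne`: the crossed classes
  `g_j^* b_τ 0 ⌣ g_{j'}^* b_τ 1 + g_{j'}^* b_τ 0 ⌣ g_j^* b_τ 1` of two slots AT THE SAME PLACE lie in
  `D¹(B) ⊗ ℂ` (`= (g_j + g_{j'})^* θ_τ - g_j^* θ_τ - g_{j'}^* θ_τ`, as in the tree's one-curve lemma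
  `slotLetters_cross_mem_span_rational_oneOne`); `sum_pairingTensor_smul_rmLetters_mem`,
  `wordEval_rmLetters_mem_divisorClassesSpan_of_colourwise`: a coefficient function killed, slice by
  slice along slot-and-place words, by `E₀₁` and `h` placed at the positions of each place evaluates on
  the letters into `Dᵖ(B) ⊗ ℂ` (the tree's colourwise first fundamental theorem
  `mem_span_pairingTensor_of_colourwise` and (E9′a/b) `sum_pairingTensor_smul_eq`,
  `sum_cupPowOne_pairWord_mem_of_columns`, with colour = place).

## References

* [Ribet1983] K. A. Ribet, *Hodge classes on certain types of abelian varieties*, Amer. J. Math. 105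
  (1983) 523–538, Thm. 0–1. [cite: Ribet1983, Thm. 0–1]
* [Hazama1983] F. Hazama, Tôhoku Math. J. 35 (1983) 303–308, Thm. (1.1), §3 pp. 305–306.
  [cite: Hazama1983, Thm. (1.1) and §3 (pp. 305–306)]
* [Gordon1997] B. B. Gordon, arXiv:alg-geom/9709030, §3 and Thms. 6.2–6.3. [cite: Gordon1997, §3 and Thms. 6.2–6.3]
* [GoodmanWallachGTM255] R. Goodman, N. R. Wallach, GTM 255 (2009), §4.1.1, Thm. 5.3.3.
  [cite: GoodmanWallachGTM255, §4.1.1 and Thm. 5.3.3]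
* [LangeBirkenhake1992] H. Lange, Ch. Birkenhake, *Complex Abelian Varieties* (1992), Thm. 4.2.1, §5.
  [cite: LangeBirkenhake1992, Thm. 4.2.1 and §5]
* [VoisinHodgeI2002] C. Voisin, *Hodge Theory I* (2002), §7.1.2, §11.3.1. [cite: VoisinHodgeI2002, §7.1.2]
-/

noncomputable section

open scoped TensorProduct
open CategoryTheory Module NumberField

namespace Literature.AlgebraicGeometry.HodgeTheory

open Literature.AlgebraicTopology.SingularHomology
open Literature.AlgebraicGeometry.Motives (IsSmoothProjective AbelianVariety bettiCohomology
  ofRatClassBaseChange ofRatClassBaseChange_tmul HodgeTensorFacts)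
open Literature.AlgebraicGeometry.Motives.HodgeStructure
open Literature.AlgebraicGeometry.ComplexMultiplication
open Literature.Barriers.HodgeConjecture
open Literature.RepresentationTheory.GeneralLinear
open Literature.NumberTheory.DiophantineGeometry

/-! ### §1 The `ψ`-Casimir classes: `b_τ 0 ⌣ b_τ 1` is a combination of rational `(1,1)`-classes -/

section Generic

variable {K : Type*} [Field K] {W : Type*} [AddCommGroup W] [Module K W] {P : Type*} [AddCommGroup P]
  [Module K P]

/-- **Independence of the Casimir contraction from the pair of dual bases.** For a bilinear form `Ψ`, a
bilinear `β`, a pair `(w, d)` with the reproducing property `x = ∑_i Ψ(x, w_i) d_i`, and a pair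
`(w', d')` with `Ψ(d'_j, w'_k) = δ_{jk}` whose `d'` separates (`Ψ(d'_j, y) = 0 ∀ j ⟹ y = 0`):
`∑_i β(Y d_i, w_i) = ∑_j β(Y d'_j, w'_j)` for every operator `Y` (the element `∑_i d_i ⊗ w_i = Ψ⁻¹` is
canonical). [cite: GoodmanWallachGTM255, §4.1.1] -/
theorem sum_dual_eq_sum_dual (Ψ : LinearMap.BilinForm K W) (β : W →ₗ[K] W →ₗ[K] P) {I J : Type*}
    [Fintype I] [Fintype J] [DecidableEq J] (w d : I → W) (hrep : ∀ x, x = ∑ i, Ψ x (w i) • d i)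
    (w' d' : J → W)
    (hdual : ∀ j k, Ψ (d' j) (w' k) = if k = j then 1 else 0)
    (hsep : ∀ y, (∀ j, Ψ (d' j) y = 0) → y = 0) (Y : Module.End K W) :
    ∑ i, β (Y (d i)) (w i) = ∑ j, β (Y (d' j)) (w' j) := by
  have hz : ∀ i, ∑ j, Ψ (d' j) (w i) • w' j = w i := fun i => by
    refine sub_eq_zero.1 (hsep _ fun k => ?_)
    rw [map_sub, map_sum]
    simp only [map_smul, smul_eq_mul, hdual, mul_ite, mul_one, mul_zero]
    rw [Finset.sum_ite_eq', if_pos (Finset.mem_univ _), sub_self]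
  have h1 : ∀ j, β (Y (d' j)) (w' j) = ∑ i, Ψ (d' j) (w i) • β (Y (d i)) (w' j) := fun j => by
    conv_lhs => rw [hrep (d' j)]
    rw [map_sum, map_sum, LinearMap.sum_apply]
    simp only [map_smul, LinearMap.smul_apply]
  symm
  calc ∑ j, β (Y (d' j)) (w' j) = ∑ j, ∑ i, Ψ (d' j) (w i) • β (Y (d i)) (w' j) :=
        Finset.sum_congr rfl fun j _ => h1 j
    _ = ∑ i, β (Y (d i)) (∑ j, Ψ (d' j) (w i) • w' j) := by
        rw [Finset.sum_comm]
        refine Finset.sum_congr rfl fun i _ => ?_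
        rw [map_sum]
        simp only [map_smul]
    _ = ∑ i, β (Y (d i)) (w i) := Finset.sum_congr rfl fun i _ => by rw [hz i]

end Generic

section Casimir

universe u

variable {V : Type u} [AddCommGroup V] [Module ℚ V]

/-- **The reproducing property of a rational basis and its `ψ`-dual basis, after complexification**:
`x = ∑_i ψ_ℂ(x, 1 ⊗ e_i) · (1 ⊗ d_i)` on `V_ℂ`, `d` the `ψ`-dual basis of `e` (`ψ(d_i, e_j) = δ_{ij}`).
[cite: GoodmanWallachGTM255, §4.1.1] -/
theorem eq_sum_formBaseChange_smul_dualBasis (φ : LinearMap.BilinForm ℚ V) (hφ : φ.Nondegenerate)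
    {ι : Type*} [Fintype ι] [DecidableEq ι] (e : Module.Basis ι ℚ V) (x : ℂ ⊗[ℚ] V) :
    x = ∑ i, φ.baseChange ℂ x ((1 : ℂ) ⊗ₜ e i) • ((1 : ℂ) ⊗ₜ[ℚ] φ.dualBasis hφ e i) := by
  induction x using TensorProduct.induction_on with
  | zero => simp
  | tmul c v =>
    have hv : ∑ i, φ v (e i) • φ.dualBasis hφ e i = v := by
      conv_rhs => rw [← (φ.dualBasis hφ e).sum_repr v]
      simp only [LinearMap.BilinForm.dualBasis_repr_apply]
    conv_lhs => rw [← hv, TensorProduct.tmul_sum]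
    refine Finset.sum_congr rfl fun i _ => ?_
    rw [LinearMap.BilinForm.baseChange_tmul, mul_one, TensorProduct.tmul_smul, TensorProduct.smul_tmul',
      TensorProduct.smul_tmul', smul_eq_mul, mul_one]
  | add x y hx hy =>
    conv_lhs => rw [hx, hy]
    rw [← Finset.sum_add_distrib]
    refine Finset.sum_congr rfl fun i _ => ?_
    rw [map_add, LinearMap.add_apply, add_smul]

end Casimir

section RM

variable {A B : AbelianVariety ℂ} {n : ℕ}

/-- **The letters attached to block bases**: for bases `b_τ` of subspaces `W_τ ⊆ H¹(A(ℂ); ℚ) ⊗ ℂ` and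
slots `g`, the classes `g_j^* ρ(b_τ r) ∈ H¹(B(ℂ); ℂ)` indexed by `((j, τ), r)` (`ρ` the comparison
`H¹(A; ℚ) ⊗ ℂ → H¹(A(ℂ); ℂ)`). Hazama 1983 §3: `H¹(Aⁿ, ℂ) = (V₁ ⊕ ⋯ ⊕ V_k)^{⊕n}`.
[cite: Hazama1983, §3 (p. 306)] [cite: LangeBirkenhake1992, Thm. 4.2.1] -/
def rmLetters (g : Fin n → (B ⟶ A)) {T : Type*} {W : T → Submodule ℂ (ℂ ⊗[ℚ] bettiCohomology A.X 1)}
    (b : ∀ τ, Module.Basis (Fin 2) ℂ (W τ)) : (Fin n × T) × Fin 2 → complexBetti B.X 1 :=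
  fun jr => complexBetti.map (g jr.1.1).hom.hom.hom 1
    (ofRatClassBaseChange (Motives.ComplexPoints A.X) 1 (b jr.1.2 jr.2 : ℂ ⊗[ℚ] bettiCohomology A.X 1))

/-- Unfolding `rmLetters`. [cite: Hazama1983, §3 (p. 306)] -/
theorem rmLetters_apply (g : Fin n → (B ⟶ A)) {T : Type*}
    {W : T → Submodule ℂ (ℂ ⊗[ℚ] bettiCohomology A.X 1)} (b : ∀ τ, Module.Basis (Fin 2) ℂ (W τ))
    (j : Fin n) (τ : T) (r : Fin 2) :
    rmLetters g b ((j, τ), r) = complexBetti.map (g j).hom.hom.hom 1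
      (ofRatClassBaseChange (Motives.ComplexPoints A.X) 1 (b τ r : ℂ ⊗[ℚ] bettiCohomology A.X 1)) :=
  rfl

variable (A) in
/-- The cup product of two classes of `H¹(A; ℚ) ⊗ ℂ`, read in `H²(A(ℂ); ℂ)` through the comparison `ρ`.
[cite: VoisinHodgeI2002, §7.1.2] -/
def cupH1 : (ℂ ⊗[ℚ] bettiCohomology A.X 1) →ₗ[ℂ] (ℂ ⊗[ℚ] bettiCohomology A.X 1) →ₗ[ℂ]
    complexBetti A.X 2 :=
  (cupProduct (rfl : 1 + 1 = 2)).compl₁₂ (ofRatClassBaseChange (Motives.ComplexPoints A.X) 1)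
    (ofRatClassBaseChange (Motives.ComplexPoints A.X) 1)

/-- Unfolding `cupH1`. [cite: VoisinHodgeI2002, §7.1.2] -/
theorem cupH1_apply (x y : ℂ ⊗[ℚ] bettiCohomology A.X 1) :
    cupH1 A x y = cupProduct (rfl : 1 + 1 = 2) (ofRatClassBaseChange (Motives.ComplexPoints A.X) 1 x)
      (ofRatClassBaseChange (Motives.ComplexPoints A.X) 1 y) :=
  rfl

variable (A) in
/-- **The `ψ`-Casimir class of an operator `Y` of `H¹(A; ℚ) ⊗ ℂ`**: `Λ(Y) = ∑_i ρ(Y (1 ⊗ d_i)) ⌣ ρ(1 ⊗ e_i)`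
for a rational basis `e` and its `ψ`-dual basis `d`. [cite: GoodmanWallachGTM255, §4.1.1]
[cite: Ribet1983, Thm. 0–1] -/
def casimirClass (φ : LinearMap.BilinForm ℚ (bettiCohomology A.X 1)) (hφ : φ.Nondegenerate)
    {ι : Type*} [Fintype ι] [DecidableEq ι] (e : Module.Basis ι ℚ (bettiCohomology A.X 1)) :
    Module.End ℂ (ℂ ⊗[ℚ] bettiCohomology A.X 1) →ₗ[ℂ] complexBetti A.X 2 where
  toFun Y := ∑ i, cupH1 A (Y ((1 : ℂ) ⊗ₜ φ.dualBasis hφ e i)) ((1 : ℂ) ⊗ₜ e i)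
  map_add' Y Y' := by
    rw [← Finset.sum_add_distrib]
    exact Finset.sum_congr rfl fun i _ => by rw [LinearMap.add_apply, map_add, LinearMap.add_apply]
  map_smul' c Y := by
    rw [RingHom.id_apply, Finset.smul_sum]
    exact Finset.sum_congr rfl fun i _ => by rw [LinearMap.smul_apply, map_smul, LinearMap.smul_apply]

/-- Unfolding `casimirClass`. [cite: GoodmanWallachGTM255, §4.1.1] -/
theorem casimirClass_apply (φ : LinearMap.BilinForm ℚ (bettiCohomology A.X 1)) (hφ : φ.Nondegenerate)
    {ι : Type*} [Fintype ι] [DecidableEq ι] (e : Module.Basis ι ℚ (bettiCohomology A.X 1))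
    (Y : Module.End ℂ (ℂ ⊗[ℚ] bettiCohomology A.X 1)) :
    casimirClass A φ hφ e Y = ∑ i, cupH1 A (Y ((1 : ℂ) ⊗ₜ φ.dualBasis hφ e i)) ((1 : ℂ) ⊗ₜ e i) :=
  rfl

/-- **The Casimir class of `a ⊗ 1`, `a` rational, is a rational class** (rational bases, rational cup
products). [cite: VoisinHodgeI2002, §7.1.1 and §11.3.1] -/
theorem isRationalClass_casimirClass_baseChange (φ : LinearMap.BilinForm ℚ (bettiCohomology A.X 1))
    (hφ : φ.Nondegenerate) {ι : Type*} [Fintype ι] [DecidableEq ι]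
    (e : Module.Basis ι ℚ (bettiCohomology A.X 1)) (a : Module.End ℚ (bettiCohomology A.X 1)) :
    IsRationalClass (casimirClass A φ hφ e (a.baseChange ℂ)) := by
  rw [casimirClass_apply]
  refine isRationalClass_sum _ _ fun i _ => ?_
  rw [LinearMap.baseChange_tmul, cupH1_apply, ofRatClassBaseChange_tmul,
    ofRatClassBaseChange_tmul, one_smul, one_smul]
  exact (isRationalClass_ofRatClass _).cup _ (isRationalClass_ofRatClass _)

/-- A number field has positive degree over `ℚ` (instance path through `NumberField`). [folklore] -/
private theorem finrank_pos_of_numberField' (E : Type*) [Field E] [NumberField E] :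
    0 < Module.finrank ℚ E :=
  Module.finrank_pos

variable (A) in
/-- The weight-one `ℚ`-Hodge structure `H¹(A(ℂ); ℚ)` of the tree's Betti universe (proof-internal
abbreviation). [folklore] -/
private abbrev H1 (hHD : exists_isReal_hodgeModel) :=
  BettiUniverse.hodge hHD (AbelianVariety.isSmoothProjective_holds (A := A)) 1

variable (hF : IsField A.endAlgebra)

include hF in
/-- `dim A > 0` when `[End⁰(A) : ℚ] = dim A`. [folklore] -/
private theorem dim_pos_of_finrank_eq' (hdeg : Module.finrank ℚ A.endAlgebra = A.dim) : 0 < A.dim := by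
  have h := finrank_pos_of_numberField' (EndField A hF)
  rw [EndField.finrank_eq hF, hdeg] at h
  exact h

/-- **The Casimir class in adapted block coordinates.** For `A` with `End⁰(A)` a totally real field of
degree `dim A`, block bases `b_τ` of `H ⊗ ℂ = ⊕_τ V_τ` and `ω_τ = ψ_ℂ(b_τ 0, b_τ 1)`:
`Λ(Y) = ∑_τ ω_τ⁻¹ (ρ(Y b_τ 0) ⌣ ρ(b_τ 1) - ρ(Y b_τ 1) ⌣ ρ(b_τ 0))` (the `ψ_ℂ`-dual family of the block
basis is `(-ω_τ⁻¹ b_τ 1, ω_τ⁻¹ b_τ 0)`: the blocks are `ψ_ℂ`-orthogonal, `ψ_ℂ` is alternating and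
non-degenerate). [cite: Hazama1983, §3 (p. 305)] [cite: GoodmanWallachGTM255, §4.1.1] -/
theorem casimirClass_eq_sum_blocks (hHD : exists_isReal_hodgeModel)
    (hI : hodgePQ_independent_of_hodgeModel) [IsTotallyReal (EndField A hF)]
    (hdeg : Module.finrank ℚ A.endAlgebra = A.dim)
    (ψ : (BettiUniverse.hodge hHD (AbelianVariety.isSmoothProjective_holds (A := A)) 1).Polarization)
    (b : ∀ τ : EndField A hF →+* ℂ, Module.Basis (Fin 2) ℂ
      ((BettiUniverse.hodge hHD (AbelianVariety.isSmoothProjective_holds (A := A)) 1).eigenBlock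
        (hodgeCharacter hF hHD hI τ)))
    {ι : Type*} [Fintype ι] [DecidableEq ι] (e : Module.Basis ι ℚ (bettiCohomology A.X 1))
    (Y : Module.End ℂ (ℂ ⊗[ℚ] bettiCohomology A.X 1)) :
    casimirClass A ψ.form ψ.nondegenerate e Y =
      ∑ τ, (ψ.form.baseChange ℂ (b τ 0 : ℂ ⊗[ℚ] bettiCohomology A.X 1) (b τ 1))⁻¹ •
        (cupH1 A (Y (b τ 0)) (b τ 1) - cupH1 A (Y (b τ 1)) (b τ 0)) := by
  classical
  haveI : Module.Finite ℚ (bettiCohomology A.X 1) := finite_bettiCohomology_one A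
  have hint := isInternal_eigenBlock_hodgeCharacter hF hHD hI
  have hA0 : 0 < A.dim := dim_pos_of_finrank_eq' hF hdeg
  have hself := isAdjointPair_self_of_isTotallyReal hF hHD hI hA0 ψ
  have hodd : Odd (((1 : ℕ) : ℤ)) := ⟨0, by norm_num⟩
  have hσinj := injective_of_isInternal_eigenBlock (H1 A hHD) (hodgeCharacter hF hHD hI) hint b
  set Ψ := ψ.form.baseChange ℂ with hΨ
  set ω : (EndField A hF →+* ℂ) → ℂ := fun τ => Ψ (b τ 0 : ℂ ⊗[ℚ] bettiCohomology A.X 1) (b τ 1)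
    with hω
  have hω0 : ∀ τ, ω τ ≠ 0 := fun τ =>
    form_basis_ne_zero (H1 A hHD) hodd ψ hself (hodgeCharacter hF hHD hI) hint b τ
  -- the block family and its dual family
  set w' : (EndField A hF →+* ℂ) × Fin 2 → ℂ ⊗[ℚ] bettiCohomology A.X 1 := fun τr => b τr.1 τr.2
    with hw'
  set d' : (EndField A hF →+* ℂ) × Fin 2 → ℂ ⊗[ℚ] bettiCohomology A.X 1 := fun τr =>
    if τr.2 = 0 then -(ω τr.1)⁻¹ • (b τr.1 1 : ℂ ⊗[ℚ] bettiCohomology A.X 1)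
    else (ω τr.1)⁻¹ • (b τr.1 0 : ℂ ⊗[ℚ] bettiCohomology A.X 1) with hd'
  have hcross : ∀ {τ τ' : EndField A hF →+* ℂ} (r r' : Fin 2), τ ≠ τ' →
      Ψ (b τ r : ℂ ⊗[ℚ] bettiCohomology A.X 1) (b τ' r') = 0 := fun r r' hne =>
    form_eq_zero_of_mem_eigenBlock_of_isAdjointPair (H1 A hHD) ψ hself (fun h => hne (hσinj h))
      (b _ r).2 (b _ r').2
  have hself0 : ∀ τ r, Ψ (b τ r : ℂ ⊗[ℚ] bettiCohomology A.X 1) (b τ r) = 0 := fun τ r =>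
    form_baseChange_self_eq_zero_of_odd (H1 A hHD) hodd ψ _
  have hswap : ∀ τ, Ψ (b τ 1 : ℂ ⊗[ℚ] bettiCohomology A.X 1) (b τ 0) = -ω τ := fun τ =>
    form_baseChange_swap_of_odd (H1 A hHD) hodd ψ _ _
  have hd'0 : ∀ τ, d' (τ, 0) = -(ω τ)⁻¹ • (b τ 1 : ℂ ⊗[ℚ] bettiCohomology A.X 1) := fun τ => if_pos rfl
  have hd'1 : ∀ τ, d' (τ, 1) = (ω τ)⁻¹ • (b τ 0 : ℂ ⊗[ℚ] bettiCohomology A.X 1) := fun τ =>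
    if_neg one_ne_zero
  have hw'r : ∀ τ r, w' (τ, r) = (b τ r : ℂ ⊗[ℚ] bettiCohomology A.X 1) := fun τ r => rfl
  have hdual : ∀ j k, Ψ (d' j) (w' k) = if k = j then 1 else 0 := by
    rintro ⟨τ, r⟩ ⟨τ', r'⟩
    rw [hw'r]
    by_cases hττ' : τ = τ'
    · subst hττ'
      rcases Fin.exists_fin_two.1 ⟨r, rfl⟩ with hr | hr <;>
        rcases Fin.exists_fin_two.1 ⟨r', rfl⟩ with hr' | hr' <;> subst hr <;> subst hr'
      · rw [hd'0, if_pos rfl, map_smul, LinearMap.smul_apply, hswap, smul_eq_mul, neg_mul_neg,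
          inv_mul_cancel₀ (hω0 τ)]
      · rw [hd'0, if_neg (by simp), map_smul, LinearMap.smul_apply, hself0, smul_zero]
      · rw [hd'1, if_neg (by simp), map_smul, LinearMap.smul_apply, hself0, smul_zero]
      · rw [hd'1, if_pos rfl, map_smul, LinearMap.smul_apply, smul_eq_mul, inv_mul_cancel₀ (hω0 τ)]
    · have hne : ((τ', r') : (EndField A hF →+* ℂ) × Fin 2) ≠ (τ, r) := fun h =>
        hττ' (congrArg Prod.fst h).symm
      rw [if_neg hne]
      rcases Fin.exists_fin_two.1 ⟨r, rfl⟩ with hr | hr <;> subst hr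
      · rw [hd'0, map_smul, LinearMap.smul_apply, hcross 1 r' hττ', smul_zero]
      · rw [hd'1, map_smul, LinearMap.smul_apply, hcross 0 r' hττ', smul_zero]
  have hsep : ∀ y, (∀ j, Ψ (d' j) y = 0) → y = 0 := by
    intro y hy
    have hb : ∀ τ r, Ψ (b τ r : ℂ ⊗[ℚ] bettiCohomology A.X 1) y = 0 := by
      intro τ r
      rcases Fin.exists_fin_two.1 ⟨r, rfl⟩ with hr | hr <;> subst hr
      · have h := hy (τ, 1)
        rw [hd'1, map_smul, LinearMap.smul_apply, smul_eq_mul, mul_eq_zero] at h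
        exact h.resolve_left (inv_ne_zero (hω0 τ))
      · have h := hy (τ, 0)
        rw [hd'0, map_smul, LinearMap.smul_apply, smul_eq_mul, mul_eq_zero] at h
        exact h.resolve_left (neg_ne_zero.2 (inv_ne_zero (hω0 τ)))
    have hall : ∀ x, Ψ x y = 0 := by
      intro x
      have hx : x ∈ ⨆ τ, (H1 A hHD).eigenBlock (hodgeCharacter hF hHD hI τ) := by
        rw [hint.submodule_iSup_eq_top]; exact Submodule.mem_top
      induction hx using Submodule.iSup_induction' with
      | mem τ x hx =>
        have hx' : x = ∑ c, (b τ).repr ⟨x, hx⟩ c • (b τ c : ℂ ⊗[ℚ] bettiCohomology A.X 1) := by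
          conv_lhs => rw [show x = ((⟨x, hx⟩ : (H1 A hHD).eigenBlock (hodgeCharacter hF hHD hI τ)) : _)
            from rfl, ← (b τ).sum_repr ⟨x, hx⟩]
          simp only [Submodule.coe_sum, Submodule.coe_smul]
        rw [hx', map_sum, LinearMap.sum_apply]
        exact Finset.sum_eq_zero fun c _ => by rw [map_smul, LinearMap.smul_apply, hb, smul_zero]
      | zero => simp
      | add x x' _ _ hx hx' => rw [map_add, LinearMap.add_apply, hx, hx', add_zero]
    refine ψ.eq_zero_of_forall_form_eq_zero fun x => ?_
    rw [form_baseChange_swap_of_odd (H1 A hHD) hodd ψ, ← hΨ, hall x, neg_zero]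
  rw [casimirClass_apply, sum_dual_eq_sum_dual Ψ (cupH1 A) _ _
    (eq_sum_formBaseChange_smul_dualBasis ψ.form ψ.nondegenerate e) w' d' hdual hsep Y,
    Fintype.sum_prod_type]
  refine Finset.sum_congr rfl fun τ _ => ?_
  rw [Fin.sum_univ_two, hw'r, hw'r, hd'0, hd'1, map_smul, map_smul, map_smul, map_smul,
    LinearMap.smul_apply, LinearMap.smul_apply, neg_smul, smul_sub]
  abel

/-- **The block projector `p_τ` lies in `End_Hdg(H¹) ⊗ ℂ`** (it commutes with `Lie Hdg ⊗ ℂ ∋ Θ`, whose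
elements preserve the blocks; `ThetaSubalgebra.mem_span_endAlg_of_forall_commute`). Hazama 1983 §3: the
projections `p_i` onto the `V_i` come from `End⁰(A) ⊗ ℂ`. [cite: Hazama1983, §3 (p. 305)] -/
theorem assemble_single_one_mem_span_endAlg [HodgeTensorFacts.{0, 0}]
    [Module.Finite ℚ (bettiCohomology A.X 1)] (hHD : exists_isReal_hodgeModel)
    (hI : hodgePQ_independent_of_hodgeModel) [DecidableEq (EndField A hF →+* ℂ)]
    (b : ∀ τ : EndField A hF →+* ℂ, Module.Basis (Fin 2) ℂ
      ((BettiUniverse.hodge hHD (AbelianVariety.isSmoothProjective_holds (A := A)) 1).eigenBlock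
        (hodgeCharacter hF hHD hI τ)))
    (τ : EndField A hF →+* ℂ) :
    RealPlaces.assemble (isInternal_eigenBlock_hodgeCharacter hF hHD hI) b
        (Pi.single τ (1 : Matrix (Fin 2) (Fin 2) ℂ)) ∈
      Submodule.span ℂ ((fun a : Module.End ℚ (bettiCohomology A.X 1) => a.baseChange ℂ) ''
        ((BettiUniverse.hodge hHD (AbelianVariety.isSmoothProjective_holds (A := A)) 1).endAlg :
          Set (Module.End ℚ (bettiCohomology A.X 1)))) := by
  have hint := isInternal_eigenBlock_hodgeCharacter hF hHD hI
  set P := RealPlaces.assemble hint b (Pi.single τ (1 : Matrix (Fin 2) (Fin 2) ℂ)) with hP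
  obtain ⟨Θ, hΘ⟩ := exists_hodgeTheta (H1 A hHD)
  have hΘC : Θ ∈ spanC (H1 A hHD).hodgeLie := by
    rw [← hodgeLieC_eq_spanC]; exact (H1 A hHD).mem_hodgeLieC_of_forall_piece hΘ
  -- `P` acts on the block `V_τ'` by the scalar `[τ' = τ]`
  have hPbasis : ∀ τ' c, P (b τ' c : ℂ ⊗[ℚ] bettiCohomology A.X 1) =
      (if τ' = τ then (1 : ℂ) else 0) • (b τ' c : ℂ ⊗[ℚ] bettiCohomology A.X 1) := by
    intro τ' c
    rw [hP, RealPlaces.assemble_apply_basis]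
    by_cases hτ : τ' = τ
    · subst hτ
      rw [Pi.single_eq_same, if_pos rfl, one_smul, Fin.sum_univ_two]
      rcases Fin.exists_fin_two.1 ⟨c, rfl⟩ with hc | hc <;> subst hc
      · rw [Matrix.one_apply_eq, Matrix.one_apply_ne (by decide), one_smul, zero_smul, add_zero]
      · rw [Matrix.one_apply_eq, Matrix.one_apply_ne (by decide), one_smul, zero_smul, zero_add]
    · rw [Pi.single_eq_of_ne hτ, if_neg hτ, zero_smul]
      simp only [Matrix.zero_apply, zero_smul, Finset.sum_const_zero]
  have hPb : ∀ τ' (x : ℂ ⊗[ℚ] bettiCohomology A.X 1),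
      x ∈ (H1 A hHD).eigenBlock (hodgeCharacter hF hHD hI τ') →
      P x = (if τ' = τ then (1 : ℂ) else 0) • x := by
    intro τ' x hx
    have hx' : x = ∑ c, (b τ').repr ⟨x, hx⟩ c • (b τ' c : ℂ ⊗[ℚ] bettiCohomology A.X 1) := by
      conv_lhs => rw [show x = ((⟨x, hx⟩ : (H1 A hHD).eigenBlock (hodgeCharacter hF hHD hI τ')) : _)
        from rfl, ← (b τ').sum_repr ⟨x, hx⟩]
      simp only [Submodule.coe_sum, Submodule.coe_smul]
    rw [hx', map_sum, Finset.smul_sum]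
    refine Finset.sum_congr rfl fun c _ => ?_
    rw [map_smul, hPbasis, smul_comm]
  refine ThetaSubalgebra.mem_span_endAlg_of_forall_commute (H1 A hHD) (H1 A hHD).hodgeLie hΘ hΘC
    fun X hX => ?_
  have hXT : ∀ τ', Set.MapsTo (X.baseChange ℂ) ((H1 A hHD).eigenBlock (hodgeCharacter hF hHD hI τ'))
      ((H1 A hHD).eigenBlock (hodgeCharacter hF hHD hI τ')) :=
    mapsTo_of_mem_hodgeLieC (H1 A hHD) (hodgeCharacter hF hHD hI) (baseChange_mem_spanC hX)
  refine LinearMap.ext fun x => ?_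
  have hx : x ∈ ⨆ τ', (H1 A hHD).eigenBlock (hodgeCharacter hF hHD hI τ') := by
    rw [hint.submodule_iSup_eq_top]; exact Submodule.mem_top
  induction hx using Submodule.iSup_induction' with
  | mem τ' x hx =>
    rw [Module.End.mul_apply, Module.End.mul_apply, hPb τ' x hx, hPb τ' _ (hXT τ' hx), map_smul]
  | zero => simp
  | add x x' _ _ hx hx' => rw [map_add, map_add, hx, hx']

/-- **Theorem (`b_τ 0 ⌣ b_τ 1 ∈ B¹(A) ⊗ ℂ`).** For `A` with `End⁰(A)` a totally real field of degree
`dim A`, a polarization `ψ` of `H¹(A(ℂ); ℚ)` and block bases `b_τ` ADAPTED to the Hodge decomposition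
(`b_τ 0 ∈ H^{1,0}`, `b_τ 1 ∈ H^{0,1}`), the class `ρ(b_τ 0) ⌣ ρ(b_τ 1) ∈ H²(A(ℂ); ℂ)` is a `ℂ`-combination
of rational `(1,1)`-classes: `(2/ω_τ) θ_τ = Λ(p_τ) ∈ span_ℂ {Λ(a ⊗ 1) : a ∈ End_Hdg}`, and each
`Λ(a ⊗ 1)` is rational (`isRationalClass_casimirClass_baseChange`) and of type `(1,1)`
(`casimirClass_eq_sum_blocks`: `a` is the scalar `τ(a)` on `V_τ`). Ribet: the divisor classes of `A`
account for the degree-two invariants of `Hg = R_{E/ℚ} SL₂`; Hazama §3 (`p = 1`).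
[cite: Ribet1983, Thm. 0–1 (pp. 523–525)] [cite: Hazama1983, §3 (pp. 305–306)] -/
theorem theta_mem_span_rational_oneOne [HodgeTensorFacts.{0, 0}] (hHD : exists_isReal_hodgeModel)
    (hI : hodgePQ_independent_of_hodgeModel) [IsTotallyReal (EndField A hF)]
    (hdeg : Module.finrank ℚ A.endAlgebra = A.dim)
    (ψ : (BettiUniverse.hodge hHD (AbelianVariety.isSmoothProjective_holds (A := A)) 1).Polarization)
    (b : ∀ τ : EndField A hF →+* ℂ, Module.Basis (Fin 2) ℂ
      ((BettiUniverse.hodge hHD (AbelianVariety.isSmoothProjective_holds (A := A)) 1).eigenBlock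
        (hodgeCharacter hF hHD hI τ)))
    (hb0 : ∀ τ, (b τ 0 : ℂ ⊗[ℚ] bettiCohomology A.X 1) ∈
      (BettiUniverse.hodge hHD (AbelianVariety.isSmoothProjective_holds (A := A)) 1).piece 1 0)
    (hb1 : ∀ τ, (b τ 1 : ℂ ⊗[ℚ] bettiCohomology A.X 1) ∈
      (BettiUniverse.hodge hHD (AbelianVariety.isSmoothProjective_holds (A := A)) 1).piece 0 1)
    (τ : EndField A hF →+* ℂ) :
    cupH1 A (b τ 0 : ℂ ⊗[ℚ] bettiCohomology A.X 1) (b τ 1) ∈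
      Submodule.span ℂ {c : complexBetti A.X 2 | IsRationalClass c ∧ IsOfHodgeType A.dim A.X 2 1 1 c} := by
  classical
  have hX : IsSmoothProjective A.dim A.X := AbelianVariety.isSmoothProjective_holds
  haveI : Module.Finite ℚ (bettiCohomology A.X 1) := finite_bettiCohomology_one A
  have hint := isInternal_eigenBlock_hodgeCharacter hF hHD hI
  have hA0 : 0 < A.dim := dim_pos_of_finrank_eq' hF hdeg
  have hself := isAdjointPair_self_of_isTotallyReal hF hHD hI hA0 ψ
  have hodd : Odd (((1 : ℕ) : ℤ)) := ⟨0, by norm_num⟩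
  have hω0 : ∀ τ, ψ.form.baseChange ℂ (b τ 0 : ℂ ⊗[ℚ] bettiCohomology A.X 1) (b τ 1) ≠ 0 := fun τ =>
    form_basis_ne_zero (H1 A hHD) hodd ψ hself (hodgeCharacter hF hHD hI) hint b τ
  set e := Module.finBasis ℚ (bettiCohomology A.X 1) with he
  set Λ := casimirClass A ψ.form ψ.nondegenerate e with hΛ
  set S := Submodule.span ℂ
    {c : complexBetti A.X 2 | IsRationalClass c ∧ IsOfHodgeType A.dim A.X 2 1 1 c} with hS
  -- Hodge types of the block letters
  have ht0 : ∀ τ, IsOfHodgeType A.dim A.X 1 1 0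
      (ofRatClassBaseChange (Motives.ComplexPoints A.X) 1 (b τ 0 : ℂ ⊗[ℚ] bettiCohomology A.X 1)) :=
    fun τ => (BettiUniverse.mem_hodge_piece_iff hHD hI hX (k := 1) (p := 1) (q := 0) rfl _).1 (hb0 τ)
  have ht1 : ∀ τ, IsOfHodgeType A.dim A.X 1 0 1
      (ofRatClassBaseChange (Motives.ComplexPoints A.X) 1 (b τ 1 : ℂ ⊗[ℚ] bettiCohomology A.X 1)) :=
    fun τ => (BettiUniverse.mem_hodge_piece_iff hHD hI hX (k := 1) (p := 0) (q := 1) rfl _).1 (hb1 τ)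
  have hcup := BettiUniverse.cupPreservesHodgeType hHD hI hX
  have h01 : ∀ τ τ', IsOfHodgeType A.dim A.X 2 1 1
      (cupH1 A (b τ 0 : ℂ ⊗[ℚ] bettiCohomology A.X 1) (b τ' 1)) := fun τ τ' => by
    have h : IsOfHodgeType A.dim A.X 2 (1 + 0) (0 + 1) _ := hcup (rfl : 1 + 1 = 2) (ht0 τ) (ht1 τ')
    rw [cupH1_apply]
    exact h
  have h10 : ∀ τ τ', IsOfHodgeType A.dim A.X 2 1 1
      (cupH1 A (b τ 1 : ℂ ⊗[ℚ] bettiCohomology A.X 1) (b τ' 0)) := fun τ τ' => by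
    have h : IsOfHodgeType A.dim A.X 2 (0 + 1) (1 + 0) _ := hcup (rfl : 1 + 1 = 2) (ht1 τ) (ht0 τ')
    rw [cupH1_apply]
    exact h
  -- (1) `Λ(a ⊗ 1) ∈ S` for `a ∈ End_Hdg`
  have hΛa : ∀ a : (H1 A hHD).endAlg, Λ ((a : Module.End ℚ (bettiCohomology A.X 1)).baseChange ℂ) ∈ S := by
    intro a
    refine Submodule.subset_span ⟨isRationalClass_casimirClass_baseChange ψ.form ψ.nondegenerate e _,
      ?_⟩
    rw [hΛ, casimirClass_eq_sum_blocks hF hHD hI hdeg ψ b e]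
    obtain ⟨M⟩ := nonempty_hodgeModel_holds hX
    refine IsOfHodgeType.sum hX M _ _ fun τ' _ => IsOfHodgeType.smul ?_ _
    have ha : ∀ r, (a : Module.End ℚ (bettiCohomology A.X 1)).baseChange ℂ
        (b τ' r : ℂ ⊗[ℚ] bettiCohomology A.X 1) = hodgeCharacter hF hHD hI τ' a • (b τ' r : _) :=
      fun r => ((H1 A hHD).mem_eigenBlock_iff _ _).1 (b τ' r).2 a
    rw [ha, ha, map_smul, LinearMap.smul_apply, map_smul, LinearMap.smul_apply]
    exact IsOfHodgeType.sub hX ((h01 τ' τ').smul _) ((h10 τ' τ').smul _)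
  -- (2) `Λ(p_τ) ∈ S`
  set P := RealPlaces.assemble hint b (Pi.single τ (1 : Matrix (Fin 2) (Fin 2) ℂ)) with hP
  have hΛP : Λ P ∈ S := by
    have hPmem := assemble_single_one_mem_span_endAlg hF hHD hI b τ
    have hle : Submodule.span ℂ ((fun a : Module.End ℚ (bettiCohomology A.X 1) => a.baseChange ℂ) ''
        ((H1 A hHD).endAlg : Set (Module.End ℚ (bettiCohomology A.X 1)))) ≤ S.comap Λ := by
      refine Submodule.span_le.2 ?_
      rintro _ ⟨a, ha, rfl⟩
      exact hΛa ⟨a, ha⟩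
    exact hle hPmem
  -- (3) `Λ(p_τ) = (2/ω_τ) θ_τ`
  have hPb : ∀ τ' r, P (b τ' r : ℂ ⊗[ℚ] bettiCohomology A.X 1) =
      (if τ' = τ then (1 : ℂ) else 0) • (b τ' r : _) := by
    intro τ' r
    rw [hP, RealPlaces.assemble_apply_basis]
    by_cases hτ : τ' = τ
    · subst hτ
      rw [Pi.single_eq_same, if_pos rfl, one_smul, Fin.sum_univ_two]
      rcases Fin.exists_fin_two.1 ⟨r, rfl⟩ with hr | hr <;> subst hr
      · rw [Matrix.one_apply_eq, Matrix.one_apply_ne (by decide), one_smul, zero_smul, add_zero]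
      · rw [Matrix.one_apply_eq, Matrix.one_apply_ne (by decide), one_smul, zero_smul, zero_add]
    · rw [Pi.single_eq_of_ne hτ, if_neg hτ, zero_smul]
      simp only [Matrix.zero_apply, zero_smul, Finset.sum_const_zero]
  have hΛPeq : Λ P = (2 * (ψ.form.baseChange ℂ (b τ 0 : ℂ ⊗[ℚ] bettiCohomology A.X 1) (b τ 1))⁻¹) •
      cupH1 A (b τ 0 : ℂ ⊗[ℚ] bettiCohomology A.X 1) (b τ 1) := by
    rw [hΛ, casimirClass_eq_sum_blocks hF hHD hI hdeg ψ b e, Finset.sum_eq_single τ]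
    · rw [hPb, hPb, if_pos rfl, one_smul, one_smul]
      have hgc : cupH1 A (b τ 1 : ℂ ⊗[ℚ] bettiCohomology A.X 1) (b τ 0) =
          -cupH1 A (b τ 0 : ℂ ⊗[ℚ] bettiCohomology A.X 1) (b τ 1) := by
        rw [cupH1_apply, cupH1_apply, cupProduct_gradedComm_holds ℂ (Motives.ComplexPoints A.X)
          (rfl : 1 + 1 = 2) (rfl : 1 + 1 = 2)]
        norm_num
      rw [hgc, sub_neg_eq_add, ← two_smul ℂ, smul_smul, mul_comm]
    · intro τ' _ hτ'
      rw [hPb, hPb, if_neg hτ', zero_smul, zero_smul, LinearMap.map_zero₂, LinearMap.map_zero₂, sub_zero,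
        smul_zero]
    · intro h; exact absurd (Finset.mem_univ τ) h
  have h2ω : (2 * (ψ.form.baseChange ℂ (b τ 0 : ℂ ⊗[ℚ] bettiCohomology A.X 1) (b τ 1))⁻¹) ≠ 0 :=
    mul_ne_zero two_ne_zero (inv_ne_zero (hω0 τ))
  have := S.smul_mem (2 * (ψ.form.baseChange ℂ (b τ 0 : ℂ ⊗[ℚ] bettiCohomology A.X 1) (b τ 1))⁻¹)⁻¹ hΛP
  rwa [hΛPeq, smul_smul, inv_mul_cancel₀ h2ω, one_smul] at this

/-! ### §2 Crossed classes of two slots at the same place; evaluation of colourwise invariants into `D• ⊗ ℂ` -/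

/-- **The crossed class of two slots AT THE SAME PLACE lies in `D¹(B) ⊗ ℂ`**:
`g_j^* b_τ 0 ⌣ g_{j'}^* b_τ 1 + g_{j'}^* b_τ 0 ⌣ g_j^* b_τ 1 = (g_j + g_{j'})^* θ_τ - g_j^* θ_τ - g_{j'}^* θ_τ`
with `θ_τ = b_τ 0 ⌣ b_τ 1 ∈ B¹(A) ⊗ ℂ` (`theta_mem_span_rational_oneOne`); pull-backs are additive on `H¹`
for homomorphisms, multiplicative, and preserve rational `(1,1)`-classes (the tree's one-curve lemma
`slotLetters_cross_mem_span_rational_oneOne`, now per place). [cite: Gordon1997, §3 (proof of the Theorem)]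
[cite: Ribet1983, Thm. 0–1] [cite: LangeBirkenhake1992, §5] -/
theorem rmLetters_cross_mem_span_rational_oneOne (g : Fin n → (B ⟶ A)) {T : Type*}
    {W : T → Submodule ℂ (ℂ ⊗[ℚ] bettiCohomology A.X 1)} (b : ∀ τ, Module.Basis (Fin 2) ℂ (W τ))
    (hθ : ∀ τ, cupH1 A (b τ 0 : ℂ ⊗[ℚ] bettiCohomology A.X 1) (b τ 1) ∈
      Submodule.span ℂ {c : complexBetti A.X 2 | IsRationalClass c ∧ IsOfHodgeType A.dim A.X 2 1 1 c})
    (x₁ x₂ : Fin n × T) (hx : x₁.2 = x₂.2) :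
    cupProduct (rfl : 1 + 1 = 2) (rmLetters g b (x₁, 0)) (rmLetters g b (x₂, 1)) +
        cupProduct (rfl : 1 + 1 = 2) (rmLetters g b (x₂, 0)) (rmLetters g b (x₁, 1)) ∈
      Submodule.span ℂ {c : complexBetti B.X 2 | IsRationalClass c ∧ IsOfHodgeType B.dim B.X 2 1 1 c} := by
  obtain ⟨i, τ⟩ := x₁
  obtain ⟨j, τ'⟩ := x₂
  dsimp only at hx
  subst hx
  have hB : IsSmoothProjective B.dim B.X := Motives.AbelianVariety.isSmoothProjective_holds
  have hA : IsSmoothProjective A.dim A.X := Motives.AbelianVariety.isSmoothProjective_holds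
  set f : Fin 2 → complexBetti A.X 1 := fun r =>
    ofRatClassBaseChange (Motives.ComplexPoints A.X) 1 (b τ r : ℂ ⊗[ℚ] bettiCohomology A.X 1) with hf
  set θ : complexBetti A.X 2 := cupProduct (rfl : 1 + 1 = 2) (f 0) (f 1) with hθdef
  have hθ' : θ ∈ Submodule.span ℂ
      {c : complexBetti A.X 2 | IsRationalClass c ∧ IsOfHodgeType A.dim A.X 2 1 1 c} := by
    have h := hθ τ
    rwa [cupH1_apply] at h
  have hpull : ∀ φ : B ⟶ A, complexBetti.map φ.hom.hom.hom 2 θ =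
      cupProduct (rfl : 1 + 1 = 2) (complexBetti.map φ.hom.hom.hom 1 (f 0))
        (complexBetti.map φ.hom.hom.hom 1 (f 1)) :=
    fun φ => complexBetti.map_cupProduct _ _ _ _
  have key : cupProduct (rfl : 1 + 1 = 2) (rmLetters g b ((i, τ), 0)) (rmLetters g b ((j, τ), 1)) +
        cupProduct (rfl : 1 + 1 = 2) (rmLetters g b ((j, τ), 0)) (rmLetters g b ((i, τ), 1)) =
      complexBetti.map (g i + g j).hom.hom.hom 2 θ - complexBetti.map (g i).hom.hom.hom 2 θ -
        complexBetti.map (g j).hom.hom.hom 2 θ := by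
    have hadd : ∀ v : complexBetti A.X 1, complexBetti.map (g i + g j).hom.hom.hom 1 v =
        complexBetti.map (g i).hom.hom.hom 1 v + complexBetti.map (g j).hom.hom.hom 1 v :=
      fun v => complexBetti_map_add_deg_one (g i) (g j) v
    simp only [rmLetters_apply, hpull, hadd, map_add, LinearMap.add_apply]
    abel
  rw [key]
  exact Submodule.sub_mem _ (Submodule.sub_mem _ (map_mem_span_rational_oneOne hB hA _ hθ')
    (map_mem_span_rational_oneOne hB hA _ hθ')) (map_mem_span_rational_oneOne hB hA _ hθ')

/-- **(E9′, per place) The evaluation of a pairing tensor MONOCHROMATIC IN THE PLACE on the letters along a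
slot-and-place word lies in `Dᵖ(B) ⊗ ℂ`** (`±` the product over the pairs of the crossed classes of two
slots at the same place: `sum_pairingTensor_smul_eq`, `sum_cupPowOne_pairWord_mem_of_columns`).
[cite: Gordon1997, §3 (proof of the Theorem)] [cite: GoodmanWallachGTM255, Thm. 5.3.3] -/
theorem sum_pairingTensor_smul_rmLetters_mem (g : Fin n → (B ⟶ A)) {T : Type*}
    {W : T → Submodule ℂ (ℂ ⊗[ℚ] bettiCohomology A.X 1)} (b : ∀ τ, Module.Basis (Fin 2) ℂ (W τ))
    (hθ : ∀ τ, cupH1 A (b τ 0 : ℂ ⊗[ℚ] bettiCohomology A.X 1) (b τ 1) ∈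
      Submodule.span ℂ {c : complexBetti A.X 2 | IsRationalClass c ∧ IsOfHodgeType A.dim A.X 2 1 1 c})
    {p : ℕ} (u : Fin (2 * p) → Fin n × T) (e : Fin (2 * p) ≃ Fin 2 × Fin p)
    (he : ∀ c, (u (e.symm (0, c))).2 = (u (e.symm (1, c))).2) :
    ∑ ε : Word 2 (2 * p), pairingTensor ℂ e ε •
        cupPowOneAlt ℂ (Motives.ComplexPoints B.X) (2 * p) (fun t => rmLetters g b (u t, ε t)) ∈
      divisorClassesSpan B.X B.dim p := by
  rw [sum_pairingTensor_smul_eq]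
  refine Submodule.smul_mem _ _ ?_
  simp only [cupPowOneAlt_apply]
  exact sum_cupPowOne_pairWord_mem_of_columns (rmLetters g b) p _ _ fun c =>
    rmLetters_cross_mem_span_rational_oneOne g b hθ _ _ (he c)

/-- **(E8′ + E9′, per place) A coefficient function killed, slice by slice along slot-and-place words, by
`E₀₁` and `h` at the positions of every place evaluates into `Dᵖ(B) ⊗ ℂ`** (every slice is a combination
of pairing tensors monochromatic in the place, `mem_span_pairingTensor_of_colourwise`, whose evaluations
lie in `Dᵖ ⊗ ℂ`). Hazama 1983 §3: the `𝔥`-invariants of `⊗ (V₁ ⊕ ⋯ ⊕ V_k)^{⊕n}` are generated in degree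
two (first fundamental theorem for `SL₂`, place by place). [cite: Hazama1983, Thm. (1.1) and §3 (pp. 305–306)]
[cite: GoodmanWallachGTM255, §4.1.1 and Thm. 5.3.3] -/
theorem wordEval_rmLetters_mem_divisorClassesSpan_of_colourwise (g : Fin n → (B ⟶ A)) {T : Type*}
    [DecidableEq T] {W : T → Submodule ℂ (ℂ ⊗[ℚ] bettiCohomology A.X 1)}
    (b : ∀ τ, Module.Basis (Fin 2) ℂ (W τ))
    (hθ : ∀ τ, cupH1 A (b τ 0 : ℂ ⊗[ℚ] bettiCohomology A.X 1) (b τ 1) ∈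
      Submodule.span ℂ {c : complexBetti A.X 2 | IsRationalClass c ∧ IsOfHodgeType A.dim A.X 2 1 1 c})
    [Fintype T] {p : ℕ} {a : (Fin (2 * p) → (Fin n × T) × Fin 2) → ℂ}
    (hEa : ∀ (U : Fin (2 * p) → Fin n × T) (τ : T),
      wordDerAt ℂ (colourOp ℂ (fun t => (U t).2) τ (Matrix.single 0 1 (1 : ℂ))) (wordSlice a U) = 0)
    (hHa : ∀ (U : Fin (2 * p) → Fin n × T) (τ : T),
      wordDerAt ℂ (colourOp ℂ (fun t => (U t).2) τ (Matrix.diagonal ![(1 : ℂ), -1])) (wordSlice a U) = 0) :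
    wordEval (cupPowOneAlt ℂ (Motives.ComplexPoints B.X) (2 * p)) (rmLetters g b) a ∈
      divisorClassesSpan B.X B.dim p := by
  classical
  rw [wordEval_eq_sum_wordSlice]
  refine Submodule.sum_mem _ fun U _ => ?_
  have hslice := mem_span_pairingTensor_of_colourwise (K := ℂ) p (fun t => (U t).2) (wordSlice a U)
    (hEa U) (hHa U)
  set L : (Word 2 (2 * p) → ℂ) →ₗ[ℂ] complexBetti B.X (2 * p) :=
    Fintype.linearCombination ℂ (fun ε : Word 2 (2 * p) =>
      cupPowOneAlt ℂ (Motives.ComplexPoints B.X) (2 * p) (fun t => rmLetters g b (U t, ε t))) with hL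
  have hLapply : ∀ c' : Word 2 (2 * p) → ℂ, L c' = ∑ ε, c' ε •
      cupPowOneAlt ℂ (Motives.ComplexPoints B.X) (2 * p) (fun t => rmLetters g b (U t, ε t)) :=
    fun c' => Fintype.linearCombination_apply ℂ _ c'
  rw [← hLapply]
  have hle : Submodule.span ℂ (Set.range fun e : {e : Fin (2 * p) ≃ Fin 2 × Fin p //
      ∀ c, (U (e.symm (0, c))).2 = (U (e.symm (1, c))).2} => pairingTensor ℂ e.1) ≤
      (divisorClassesSpan B.X B.dim p).comap L := by
    refine Submodule.span_le.2 ?_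
    rintro _ ⟨e, rfl⟩
    change L (pairingTensor ℂ e.1) ∈ divisorClassesSpan B.X B.dim p
    rw [hLapply]
    exact sum_pairingTensor_smul_rmLetters_mem g b hθ U e.1 e.2
  exact hle hslice

end RM

end Literature.AlgebraicGeometry.HodgeTheory

end
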